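import Summits.RiemannHypothesis.RiemannHypothesis.Theorems.WeilCombCombShapePositivityArchJensen
import Mathlib.MeasureTheory.Integral.DominatedConvergence

/-!
# The off-diagonal archimedean entries as a cosh-moment series:
# `Re W_∞(τ_x ψ_ε) = −Σ_{k ≥ 0} e^{−(2k+½)x} Φ((2k+½)ε)²`, `Φ(y) = ∫ φ₀(v) cosh(yv) dv`
# (STUB-PLAN `stub_windowCore`, helper B1, exact form; stub `stub_archEntryCoshSeries`)

Crux `WeilComb.CombShapePositivity` (item stmt-RiemannHypothesis-11229), line `Sketch`, STUB-PLAN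
`stub_windowCore` Phase B, helper B1 (`arch_entry_bounds_window`). Notation: `φ₀(u) = expNegInvGlue (1 − u²)`,
`φ_ε = ε⁻¹φ₀(·/ε)`, `ψ_ε = φ_ε ⋆ φ̃_ε`, `τ_x h = h(· − x)`, `W_∞ = weilArchTerm`, `g(t) = e^{t/2}/(2 sinh t)`,
`c_k = 2k + ½`, `Φ(y) = ∫ φ₀(v) cosh(yv) dv` (`Φ(0) = I₀ = ∫ φ₀`; `Φ(ε/2) = F_ε` is the pole's cosh-moment of
`perron_polarSums`).

B1 asks for window-uniform two-sided bounds of the entries `Re W_∞(τ_x ψ_ε)`, `x > 2ε`; the landed bounds are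
`−I₀² g(x − 2ε) ≤ · ≤ −I₀² g(x)` (…ArchOffdiagBounds, …ArchJensen). This file proves the EXACT formula behind both:

* `integral_autocorr_mul_exp` — for a continuous compactly supported real profile `f` with autocorrelation
  `P = f ⋆ f(−·)`: `∫ P(s) e^{cs} ds = (∫ f(u)e^{cu} du)(∫ f(u)e^{−cu} du)` (the weight splits over the convolution);
  for even `f` this is `(∫ f(u) cosh(cu) du)²` (`integral_autocorr_mul_exp_of_even`);
* `archIntegral_hasSum` — with `g = Σ_k e^{−c_k t}` (`WeilCombArchJensen.hasSum_archWeight`) and summation under the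
  integral: `∫₀^∞ g(t) P(t − x) dt = Σ_k e^{−c_k x} (∫ f(u) cosh(c_k u) du)²` for `supp f ⊆ [−ε, ε]`, `x > 2ε > 0`;
* `stub_archEntryCoshSeries` (registered on the crux) — for `ε > 0`, `x > 2ε`:
  **`HasSum (k ↦ e^{−(2k+½)x} · (∫ φ₀(v) cosh((2k+½)εv) dv)²) (−Re W_∞(τ_x ψ_ε))`**.
  Consequences: Jensen (`Φ ≥ I₀`), the crude bound (`Φ(y) ≤ e^{y} I₀`), and every sharper entry bound reduce to
  one-variable estimates of the cosh-moments `Φ(y)` of the fixed bump (`Φ(y)² = I₀² + O(y²)` for small `y`,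
  `Φ(y) e^{−y} → 0` for large `y`), which is where the plan's `(C−1)(2ε/x)²/(2x)` correction comes from.
-/

noncomputable section

-- the sub-problem path RiemannHypothesis/RiemannHypothesis duplicates a namespace (D-0017)
set_option linter.dupNamespace false

open scoped BigOperators ComplexConjugate Convolution
open Complex MeasureTheory Set

namespace Summit.RiemannHypothesis.RiemannHypothesis.Theorems.WeilCombArchCoshSeries

open Literature.NumberTheory.LFunctions
open Summit.RiemannHypothesis.RiemannHypothesis.Theorems.WeilCombBohrFejer
  (weilArchTerm_translate_psi_offdiag)
open Summit.RiemannHypothesis.RiemannHypothesis.Theorems.WeilCombArchJensen (hasSum_archWeight)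

/-! ### Weighted integrals of the autocorrelation -/

section RealProfile

variable {f : ℝ → ℝ}

/-- The exponentially weighted autocorrelation is again a convolution:
`(f e^{c·} ⋆ f(−·) e^{c·})(s) = (f ⋆ f(−·))(s) · e^{cs}`. [folklore] -/
private theorem conv_exp_weight (f : ℝ → ℝ) (c s : ℝ) :
    ((fun u ↦ f u * Real.exp (c * u)) ⋆[ContinuousLinearMap.mul ℝ ℝ, volume]
        (fun w ↦ f (-w) * Real.exp (c * w))) s =
      (f ⋆[ContinuousLinearMap.mul ℝ ℝ, volume] (fun v => f (-v))) s * Real.exp (c * s) := by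
  rw [convolution_def, convolution_def, ← integral_mul_const]
  refine integral_congr_ae (Filter.Eventually.of_forall fun t ↦ ?_)
  simp only [ContinuousLinearMap.mul_apply']
  have : Real.exp (c * t) * Real.exp (c * (s - t)) = Real.exp (c * s) := by
    rw [← Real.exp_add]; congr 1; ring
  calc f t * Real.exp (c * t) * (f (-(s - t)) * Real.exp (c * (s - t)))
      = f t * f (-(s - t)) * (Real.exp (c * t) * Real.exp (c * (s - t))) := by ring
    _ = f t * f (-(s - t)) * Real.exp (c * s) := by rw [this]

/-- `s ↦ (f ⋆ f(−·))(s) e^{cs}` is integrable for continuous compactly supported `f`. [folklore] -/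
theorem integrable_autocorr_mul_exp (hfc : Continuous f) (hfs : HasCompactSupport f) (c : ℝ) :
    Integrable fun s ↦ (f ⋆[ContinuousLinearMap.mul ℝ ℝ, volume] (fun v => f (-v))) s * Real.exp (c * s) := by
  have hF₁i : Integrable fun u ↦ f u * Real.exp (c * u) :=
    (hfc.mul (by fun_prop)).integrable_of_hasCompactSupport hfs.mul_right
  have hF₂i : Integrable fun w ↦ f (-w) * Real.exp (c * w) :=
    ((hfc.comp continuous_neg).mul (by fun_prop)).integrable_of_hasCompactSupport
      ((hfs.comp_homeomorph (Homeomorph.neg ℝ)).mul_right)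
  have h := hF₁i.integrable_convolution (ContinuousLinearMap.mul ℝ ℝ) hF₂i
  refine h.congr (Filter.Eventually.of_forall fun s ↦ ?_)
  exact conv_exp_weight f c s

/-- **The weight splits over the autocorrelation**: for continuous compactly supported `f`,
`∫ (f ⋆ f(−·))(s) e^{cs} ds = (∫ f(u) e^{cu} du) · (∫ f(u) e^{−cu} du)`. [folklore] -/
theorem integral_autocorr_mul_exp (hfc : Continuous f) (hfs : HasCompactSupport f) (c : ℝ) :
    ∫ s, (f ⋆[ContinuousLinearMap.mul ℝ ℝ, volume] (fun v => f (-v))) s * Real.exp (c * s) =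
      (∫ u, f u * Real.exp (c * u)) * ∫ u, f u * Real.exp (-(c * u)) := by
  have hF₁i : Integrable fun u ↦ f u * Real.exp (c * u) :=
    (hfc.mul (by fun_prop)).integrable_of_hasCompactSupport hfs.mul_right
  have hF₂i : Integrable fun w ↦ f (-w) * Real.exp (c * w) :=
    ((hfc.comp continuous_neg).mul (by fun_prop)).integrable_of_hasCompactSupport
      ((hfs.comp_homeomorph (Homeomorph.neg ℝ)).mul_right)
  have hconv := integral_convolution (L := ContinuousLinearMap.mul ℝ ℝ) (μ := volume) (ν := volume) hF₁i hF₂i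
  rw [ContinuousLinearMap.mul_apply'] at hconv
  have hF₂int : ∫ w, f (-w) * Real.exp (c * w) = ∫ u, f u * Real.exp (-(c * u)) := by
    have := integral_neg_eq_self (fun u ↦ f u * Real.exp (-(c * u))) volume
    rw [← this]
    refine integral_congr_ae (Filter.Eventually.of_forall fun w ↦ ?_)
    simp only
    congr 2
    ring
  calc ∫ s, (f ⋆[ContinuousLinearMap.mul ℝ ℝ, volume] (fun v => f (-v))) s * Real.exp (c * s)
      = ∫ s, ((fun u ↦ f u * Real.exp (c * u)) ⋆[ContinuousLinearMap.mul ℝ ℝ, volume]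
          (fun w ↦ f (-w) * Real.exp (c * w))) s := by
        refine integral_congr_ae (Filter.Eventually.of_forall fun s ↦ ?_)
        exact (conv_exp_weight f c s).symm
    _ = (∫ u, f u * Real.exp (c * u)) * ∫ w, f (-w) * Real.exp (c * w) := hconv
    _ = _ := by rw [hF₂int]

/-- For EVEN `f`: `∫ (f ⋆ f(−·))(s) e^{cs} ds = (∫ f(u) cosh(cu) du)²`. [folklore] -/
theorem integral_autocorr_mul_exp_of_even (hfc : Continuous f) (hfs : HasCompactSupport f)
    (hfev : ∀ t, f (-t) = f t) (c : ℝ) :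
    ∫ s, (f ⋆[ContinuousLinearMap.mul ℝ ℝ, volume] (fun v => f (-v))) s * Real.exp (c * s) =
      (∫ u, f u * Real.cosh (c * u)) ^ 2 := by
  rw [integral_autocorr_mul_exp hfc hfs c]
  have hF₁i : Integrable fun u ↦ f u * Real.exp (c * u) :=
    (hfc.mul (by fun_prop)).integrable_of_hasCompactSupport hfs.mul_right
  have hF₃i : Integrable fun u ↦ f u * Real.exp (-(c * u)) :=
    (hfc.mul (by fun_prop)).integrable_of_hasCompactSupport hfs.mul_right
  -- by evenness the two factors coincide
  have hsym : ∫ u, f u * Real.exp (-(c * u)) = ∫ u, f u * Real.exp (c * u) := by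
    have := integral_neg_eq_self (fun u ↦ f u * Real.exp (c * u)) volume
    rw [← this]
    refine integral_congr_ae (Filter.Eventually.of_forall fun u ↦ ?_)
    simp only
    rw [hfev]
    congr 2
    ring
  -- and their mean is the cosh-moment
  have hcosh : ∫ u, f u * Real.cosh (c * u) =
      ((∫ u, f u * Real.exp (c * u)) + ∫ u, f u * Real.exp (-(c * u))) / 2 := by
    rw [← integral_add hF₁i hF₃i, eq_div_iff two_ne_zero, ← integral_mul_const]
    refine integral_congr_ae (Filter.Eventually.of_forall fun u ↦ ?_)
    simp only
    rw [Real.cosh_eq]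
    ring
  rw [hcosh, hsym]
  ring

end RealProfile

/-! ### Summation under the integral -/

/-- The autocorrelation of `f ≥ 0` is `≥ 0`. [folklore] -/
private theorem autocorr_nonneg'' {f : ℝ → ℝ} (hf0 : ∀ t, 0 ≤ f t) (s : ℝ) :
    0 ≤ (f ⋆[ContinuousLinearMap.mul ℝ ℝ, volume] (fun v => f (-v))) s := by
  rw [convolution_def]
  exact integral_nonneg fun u => by
    simp only [Pi.zero_apply, ContinuousLinearMap.mul_apply']
    exact mul_nonneg (hf0 _) (hf0 _)

/-- If `supp f ⊆ [−ε, ε]` then `(f ⋆ f(−·))(s) = 0` for `|s| > 2ε`. [folklore] -/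
private theorem autocorr_eq_zero'' {f : ℝ → ℝ} {ε s : ℝ} (hsupp : Function.support f ⊆ Icc (-ε) ε)
    (hs : 2 * ε < |s|) : (f ⋆[ContinuousLinearMap.mul ℝ ℝ, volume] (fun v => f (-v))) s = 0 := by
  rw [convolution_def]
  refine integral_eq_zero_of_ae (Filter.Eventually.of_forall fun u => ?_)
  simp only [ContinuousLinearMap.mul_apply', Pi.zero_apply]
  by_cases hu : f u = 0
  · rw [hu, zero_mul]
  · have hu' : u ∈ Icc (-ε) ε := hsupp hu
    have hv : f (-(s - u)) = 0 := by
      by_contra hv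
      have hv' : -(s - u) ∈ Icc (-ε) ε := hsupp hv
      rw [mem_Icc] at hu' hv'
      have : |s| ≤ 2 * ε := abs_le.2 ⟨by linarith, by linarith⟩
      linarith
    rw [hv, mul_zero]

/-- The cosh-moment against a profile in `[−ε, ε]` is at most `e^{|c|ε} ∫ f`. [folklore] -/
private theorem cosh_moment_le {f : ℝ → ℝ} {ε : ℝ} (hf0 : ∀ t, 0 ≤ f t)
    (hsupp : Function.support f ⊆ Icc (-ε) ε) (hfi : Integrable f) (c : ℝ) (hc : 0 ≤ c) :
    ∫ u, f u * Real.cosh (c * u) ≤ Real.exp (c * ε) * ∫ u, f u := by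
  rw [← integral_const_mul]
  refine integral_mono_of_nonneg (Filter.Eventually.of_forall fun u ↦ mul_nonneg (hf0 u)
    (Real.cosh_pos _).le) (hfi.const_mul _) (Filter.Eventually.of_forall fun u ↦ ?_)
  simp only
  by_cases hu : f u = 0
  · simp [hu]
  · have hu' : u ∈ Icc (-ε) ε := hsupp hu
    rw [mem_Icc] at hu'
    have h1 : Real.cosh (c * u) ≤ Real.exp (|c * u|) := by
      rw [Real.cosh_eq]
      have ha : Real.exp (c * u) ≤ Real.exp (|c * u|) := Real.exp_le_exp.2 (le_abs_self _)
      have hb : Real.exp (-(c * u)) ≤ Real.exp (|c * u|) := Real.exp_le_exp.2 (neg_le_abs _)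
      linarith
    have h2 : |c * u| ≤ c * ε := by
      rw [abs_mul, abs_of_nonneg hc]
      exact mul_le_mul_of_nonneg_left (abs_le.2 ⟨hu'.1, hu'.2⟩) hc
    have h3 : Real.exp (|c * u|) ≤ Real.exp (c * ε) := Real.exp_le_exp.2 h2
    rw [mul_comm (Real.exp (c * ε))]
    exact mul_le_mul_of_nonneg_left (h1.trans h3) (hf0 u)

/-- **Summation under the integral.** For a continuous real profile `f ≥ 0`, even, with
`supp f ⊆ [−ε, ε]`, `0 < ε`, `2ε < x`, and `P = f ⋆ f(−·)`:
`Σ_k e^{−c_k x} (∫ f(u) cosh(c_k u) du)² = ∫₀^∞ g(t) P(t − x) dt`, `c_k = 2k + ½`, `g(t) = e^{t/2}/(2 sinh t)`.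
[folklore] -/
theorem archIntegral_hasSum {f : ℝ → ℝ} {ε x : ℝ} (hfc : Continuous f) (hf0 : ∀ t, 0 ≤ f t)
    (hfev : ∀ t, f (-t) = f t) (hsupp : Function.support f ⊆ Icc (-ε) ε) (hε : 0 < ε) (hx : 2 * ε < x) :
    HasSum (fun k : ℕ ↦ Real.exp (-((2 * (k : ℝ) + 1 / 2) * x)) *
        (∫ u, f u * Real.cosh ((2 * (k : ℝ) + 1 / 2) * u)) ^ 2)
      (∫ t in Ioi (0 : ℝ), Real.exp (t / 2) / (2 * Real.sinh t) *
        (f ⋆[ContinuousLinearMap.mul ℝ ℝ, volume] (fun v => f (-v))) (t - x)) := by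
  have hx0 : 0 < x := lt_trans (by positivity) hx
  have hfs : HasCompactSupport f := HasCompactSupport.of_support_subset_isCompact isCompact_Icc hsupp
  have hfi : Integrable f := hfc.integrable_of_hasCompactSupport hfs
  set P : ℝ → ℝ := f ⋆[ContinuousLinearMap.mul ℝ ℝ, volume] (fun v => f (-v)) with hP
  set g : ℝ → ℝ := fun t ↦ Real.exp (t / 2) / (2 * Real.sinh t) with hg
  set c : ℕ → ℝ := fun k ↦ 2 * (k : ℝ) + 1 / 2 with hc
  have hc0 : ∀ k, 0 < c k := fun k ↦ by rw [hc]; positivity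
  have hPz : ∀ s, 2 * ε < |s| → P s = 0 := fun s hs => autocorr_eq_zero'' hsupp hs
  have hP0 : ∀ s, 0 ≤ P s := autocorr_nonneg'' hf0
  have hwin : ∀ s, P s ≠ 0 → |s| ≤ 2 * ε := fun s hs ↦ not_lt.1 fun h ↦ hs (hPz _ h)
  -- from the half line to the line, translated
  have hline : ∫ t in Ioi (0 : ℝ), g t * P (t - x) = ∫ s, g (x + s) * P s := by
    rw [setIntegral_eq_integral_of_forall_compl_eq_zero, ← integral_add_right_eq_self _ x]
    · refine integral_congr_ae (Filter.Eventually.of_forall fun s ↦ ?_)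
      simp only
      rw [add_sub_cancel_right, add_comm]
    · intro t ht
      rw [mem_Ioi, not_lt] at ht
      rw [hPz _ (by rw [abs_of_neg (by linarith)]; linarith), mul_zero]
  -- the terms `F k s = e^{−c_k (x+s)} P(s)`
  set F : ℕ → ℝ → ℝ := fun k s ↦ Real.exp (-(c k * (x + s))) * P s with hF
  have hFsplit : ∀ k s, F k s = Real.exp (-(c k * x)) * (P s * Real.exp (-(c k) * s)) := by
    intro k s
    rw [hF]
    simp only
    rw [show -(c k * (x + s)) = -(c k * x) + -(c k) * s by ring, Real.exp_add]
    ring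
  have hFint : ∀ k, Integrable (F k) := by
    intro k
    have h := (integrable_autocorr_mul_exp hfc hfs (-(c k))).const_mul (Real.exp (-(c k * x)))
    refine h.congr (Filter.Eventually.of_forall fun s ↦ ?_)
    rw [hFsplit]
  have hF0 : ∀ k s, 0 ≤ F k s := fun k s ↦ mul_nonneg (Real.exp_pos _).le (hP0 s)
  -- the integrals of the terms
  have hFval : ∀ k, ∫ s, F k s = Real.exp (-(c k * x)) * (∫ u, f u * Real.cosh (c k * u)) ^ 2 := by
    intro k
    have h1 : ∫ s, F k s = Real.exp (-(c k * x)) * ∫ s, P s * Real.exp (-(c k) * s) := by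
      rw [← integral_const_mul]
      exact integral_congr_ae (Filter.Eventually.of_forall fun s ↦ hFsplit k s)
    rw [h1, integral_autocorr_mul_exp_of_even hfc hfs hfev (-(c k))]
    congr 1
    have : ∫ u, f u * Real.cosh (-(c k) * u) = ∫ u, f u * Real.cosh (c k * u) := by
      refine integral_congr_ae (Filter.Eventually.of_forall fun u ↦ ?_)
      simp only
      rw [neg_mul, Real.cosh_neg]
    rw [this]
  -- summability of the norms: `∫ |F k| ≤ I² e^{−c_k (x − 2ε)}`
  set I : ℝ := ∫ u, f u with hI
  have hI0 : 0 ≤ I := integral_nonneg hf0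
  have hnorm : ∀ k, ∫ s, ‖F k s‖ = ∫ s, F k s := fun k ↦
    integral_congr_ae (Filter.Eventually.of_forall fun s ↦ Real.norm_of_nonneg (hF0 k s))
  have hbound : ∀ k, ∫ s, ‖F k s‖ ≤ I ^ 2 * (Real.exp (-((x - 2 * ε) / 2)) * Real.exp (-(2 * (x - 2 * ε))) ^ k) := by
    intro k
    rw [hnorm, hFval]
    have hm := cosh_moment_le hf0 hsupp hfi (c k) (hc0 k).le
    have hm0 : 0 ≤ ∫ u, f u * Real.cosh (c k * u) :=
      integral_nonneg fun u ↦ mul_nonneg (hf0 u) (Real.cosh_pos _).le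
    have hsq : (∫ u, f u * Real.cosh (c k * u)) ^ 2 ≤ (Real.exp (c k * ε) * I) ^ 2 :=
      pow_le_pow_left₀ hm0 hm 2
    have hexp : Real.exp (-(c k * x)) * (Real.exp (c k * ε) * I) ^ 2 =
        I ^ 2 * (Real.exp (-((x - 2 * ε) / 2)) * Real.exp (-(2 * (x - 2 * ε))) ^ k) := by
      have e1 : (Real.exp (c k * ε) * I) ^ 2 = Real.exp (2 * (c k * ε)) * I ^ 2 := by
        rw [mul_pow, ← Real.exp_nat_mul]; norm_num
      have e2 : Real.exp (-(2 * (x - 2 * ε))) ^ k = Real.exp (k * (-(2 * (x - 2 * ε)))) := by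
        rw [← Real.exp_nat_mul]
      have e3 : Real.exp (-(c k * x)) * Real.exp (2 * (c k * ε)) =
          Real.exp (-((x - 2 * ε) / 2)) * Real.exp (k * (-(2 * (x - 2 * ε)))) := by
        rw [← Real.exp_add, ← Real.exp_add]
        congr 1
        simp only [hc]
        ring
      rw [e1, e2, ← mul_assoc, e3]
      ring
    calc Real.exp (-(c k * x)) * (∫ u, f u * Real.cosh (c k * u)) ^ 2
        ≤ Real.exp (-(c k * x)) * (Real.exp (c k * ε) * I) ^ 2 :=
          mul_le_mul_of_nonneg_left hsq (Real.exp_pos _).le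
      _ = _ := hexp
  have hgeom : Summable fun k : ℕ ↦ I ^ 2 * (Real.exp (-((x - 2 * ε) / 2)) * Real.exp (-(2 * (x - 2 * ε))) ^ k) := by
    refine ((summable_geometric_of_lt_one (Real.exp_pos _).le ?_).mul_left _).mul_left _
    rw [Real.exp_lt_one_iff]; linarith
  have hsum : Summable fun k ↦ ∫ s, ‖F k s‖ :=
    hgeom.of_nonneg_of_le (fun k ↦ integral_nonneg fun s ↦ norm_nonneg _) hbound
  -- summation under the integral
  have hmain := hasSum_integral_of_summable_integral_norm hFint hsum
  -- the pointwise sum is `g(x+s) P(s)`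
  have hpt : ∀ s, ∑' k, F k s = g (x + s) * P s := by
    intro s
    by_cases hPs : P s = 0
    · simp [hF, hPs]
    · have hs : |s| ≤ 2 * ε := hwin s hPs
      have hxs : 0 < x + s := by linarith [(abs_le.1 hs).1]
      have hg' := (hasSum_archWeight hxs).tsum_eq
      show (∑' k : ℕ, Real.exp (-((2 * (k : ℝ) + 1 / 2) * (x + s))) * P s) =
        Real.exp ((x + s) / 2) / (2 * Real.sinh (x + s)) * P s
      rw [tsum_mul_right, hg']
  have hint_eq : ∫ s, ∑' k, F k s = ∫ s, g (x + s) * P s :=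
    integral_congr_ae (Filter.Eventually.of_forall hpt)
  rw [hint_eq, ← hline] at hmain
  have hfun : (fun k ↦ ∫ s, F k s) = fun k : ℕ ↦ Real.exp (-((2 * (k : ℝ) + 1 / 2) * x)) *
      (∫ u, f u * Real.cosh ((2 * (k : ℝ) + 1 / 2) * u)) ^ 2 := by
    funext k
    rw [hFval]
  rw [hfun] at hmain
  exact hmain

/-! ### The entries of the fixed-shape comb -/

/-- **Stub `stub_archEntryCoshSeries` (B1, exact form; registered on crux stmt-RiemannHypothesis-11229).**
For `ε > 0` and `x > 2ε` the off-diagonal archimedean entry of the fixed-shape comb is the cosh-moment series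
`−Re W_∞(τ_x ψ_ε) = Σ_{k ≥ 0} e^{−(2k+½)x} Φ((2k+½)ε)²`, `Φ(y) = ∫ φ₀(v) cosh(yv) dv`
(Bombieri's kernel `g = Σ_k e^{−(2k+½)t}` against the autocorrelation of `φ_ε`, the exponential weights splitting
over the convolution). [folklore] -/
theorem stub_archEntryCoshSeries : ∀ ε : ℝ, 0 < ε → ∀ x : ℝ, 2 * ε < x →
    HasSum (fun k : ℕ => Real.exp (-((2 * (k : ℝ) + 1 / 2) * x)) *
        (∫ v : ℝ, expNegInvGlue (1 - v ^ 2) * Real.cosh ((2 * (k : ℝ) + 1 / 2) * ε * v)) ^ 2)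
      (-(weilArchTerm (weilTranslate
        (weilConv (fun t : ℝ => (ε : ℂ)⁻¹ * ((expNegInvGlue (1 - (t / ε) ^ 2) : ℝ) : ℂ))
          (weilReflect (fun t : ℝ => (ε : ℂ)⁻¹ * ((expNegInvGlue (1 - (t / ε) ^ 2) : ℝ) : ℂ)))) x)).re) := by
  intro ε hε x hx
  have hx0 : 0 < x := lt_trans (by positivity) hx
  have hB := weilArchTerm_translate_psi_offdiag ε hε x (by rwa [abs_of_pos hx0])
  -- the real profile `f = ε⁻¹ φ₀(·/ε)` of `φ_ε = ↑f`
  set f : ℝ → ℝ := fun t => ε⁻¹ * expNegInvGlue (1 - (t / ε) ^ 2) with hf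
  have hφ : (fun t : ℝ => (ε : ℂ)⁻¹ * ((expNegInvGlue (1 - (t / ε) ^ 2) : ℝ) : ℂ)) =
      fun t : ℝ => ((f t : ℝ) : ℂ) := by
    funext t
    simp only [hf, Complex.ofReal_mul, Complex.ofReal_inv]
  rw [hφ] at hB ⊢
  have hf0 : ∀ t, 0 ≤ f t := fun t => mul_nonneg (inv_nonneg.2 hε.le) (expNegInvGlue.nonneg _)
  have hfev : ∀ t, f (-t) = f t := fun t ↦ by simp only [hf, neg_div, neg_sq]
  have hsupp : Function.support f ⊆ Icc (-ε) ε := by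
    refine Function.support_subset_iff'.2 fun t ht => ?_
    have h1 : 1 - (t / ε) ^ 2 ≤ 0 := by
      rw [mem_Icc, not_and_or, not_le, not_le] at ht
      rcases ht with h | h
      · have h' : t / ε < -1 := by rw [div_lt_iff₀ hε]; linarith
        nlinarith
      · have h' : 1 < t / ε := by rw [lt_div_iff₀ hε]; linarith
        nlinarith
    show ε⁻¹ * expNegInvGlue (1 - (t / ε) ^ 2) = 0
    rw [expNegInvGlue.zero_of_nonpos h1, mul_zero]
  have hfc : Continuous f := by
    rw [hf]
    exact continuous_const.mul ((expNegInvGlue.contDiff (n := 0)).continuous.comp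
      (by fun_prop : Continuous fun t : ℝ => 1 - (t / ε) ^ 2))
  -- the cosh-moments of `f` are those of `φ₀` at `cε` (dilation `t = εv`)
  have hmom : ∀ c : ℝ, ∫ u, f u * Real.cosh (c * u) =
      ∫ v, expNegInvGlue (1 - v ^ 2) * Real.cosh (c * ε * v) := by
    intro c
    have h := Measure.integral_comp_div (fun v ↦ expNegInvGlue (1 - v ^ 2) * Real.cosh (c * ε * v)) ε
    have h' : ∫ u, f u * Real.cosh (c * u) =
        ε⁻¹ * ∫ u, expNegInvGlue (1 - (u / ε) ^ 2) * Real.cosh (c * ε * (u / ε)) := by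
      rw [← integral_const_mul]
      refine integral_congr_ae (Filter.Eventually.of_forall fun u ↦ ?_)
      simp only [hf]
      rw [show c * ε * (u / ε) = c * u by field_simp]
      ring
    rw [h', h, abs_of_pos hε, smul_eq_mul, ← mul_assoc, inv_mul_cancel₀ hε.ne', one_mul]
  -- the real autocorrelation `P`
  set P : ℝ → ℝ := f ⋆[ContinuousLinearMap.mul ℝ ℝ, volume] (fun v => f (-v)) with hP
  have hPz : ∀ s, 2 * ε < |s| → P s = 0 := fun s hs => autocorr_eq_zero'' hsupp hs
  -- Bombieri's integral in real form
  have hreal : ∫ t in Ioi (0 : ℝ), (Real.exp (t / 2) : ℂ) *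
      (weilTranslate (weilConv (fun t : ℝ => ((f t : ℝ) : ℂ)) (weilReflect fun t : ℝ => ((f t : ℝ) : ℂ))) x t +
        weilTranslate (weilConv (fun t : ℝ => ((f t : ℝ) : ℂ)) (weilReflect fun t : ℝ => ((f t : ℝ) : ℂ))) x (-t)) /
        (2 * Real.sinh t : ℂ) =
      ((∫ t in Ioi (0 : ℝ), Real.exp (t / 2) / (2 * Real.sinh t) * P (t - x) : ℝ) : ℂ) := by
    rw [← integral_complex_ofReal]
    refine setIntegral_congr_fun measurableSet_Ioi fun t ht => ?_
    have ht' : 0 < t := ht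
    have h0 : P (-t - x) = 0 := hPz _ (by rw [abs_of_neg (by linarith)]; linarith)
    have hconv : ∀ s, weilConv (fun t : ℝ => ((f t : ℝ) : ℂ)) (weilReflect fun t : ℝ => ((f t : ℝ) : ℂ)) s =
        ((P s : ℝ) : ℂ) := by
      intro s
      rw [hP, weilConv_apply, convolution_def, ← integral_complex_ofReal]
      congr 1 with u
      simp only [weilReflect, Complex.conj_ofReal, ContinuousLinearMap.mul_apply', Complex.ofReal_mul]
    simp only [weilTranslate, hconv, h0]
    push_cast
    ring
  rw [hB, hreal, Complex.neg_re, Complex.ofReal_re, neg_neg]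
  have h := archIntegral_hasSum hfc hf0 hfev hsupp hε hx
  simp only [hmom] at h
  rw [hP]
  convert h using 2 with k

end Summit.RiemannHypothesis.RiemannHypothesis.Theorems.WeilCombArchCoshSeries

end
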